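import Mathlib
import Summits.NavierStokesRegularity.FluidComputer.TransportGalerkinEigenFourier
import Summits.NavierStokesRegularity.FluidComputer.AbcLatticeReality
import HarnessLib

/-!
# The X0 door read backwards: a certified real eigenvalue of the linearisation about the ABC flow gives the eigen data of the KEEP theorem (instab g18, cell `ns-blowup`, 2026-08-27)

HONEST FRAMING (human ruling D-0035): nothing here is a claim about Navier–Stokes blow-up.
WHAT THIS IS NOT: not NS evidence — MODEL lane (linearisation of forced Navier–Stokes about the ABC
flow on `T³`); no certificate, number or census word moves. This file closes the EIGEN inputs
(`HOME/instab/BETA2-SPEC.md` §10 (6)) of the (β2) KEEP sentence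
`TransportGalerkinAbc.half_prediction_abc` from the OUTPUT sentence of the cell's X0 chains
(`AbcClassIIX0.isLinNSEigenvalue_of_section_eigenpairs`, `AbcClassIIEigenpair.isLinNSEigenvalue_near_of_nested_certificate`):
a certified REAL eigenvalue `Torus.IsLinNSEigenvalue ν (abcFlow A B C) μ`.

* §1 the conjugation `(Jc)(m) = conj c(−m)` preserves rapid decay, transversality and the zero mode
  (`rapidDecay_conj_neg`, `kdot_conj_neg`).
* §2 `abc_latticeEq_iff_certifierEq` — for the ABC host the tree's lattice eigen-equation
  `ν·4π²|k|² c(k) + Π_k[N(Û,c) + N(c,Û)](k) + μ c(k) = 0` (unit torus) IS the certifiers' equation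
  `−(2πν)|k|² c(k) + Π_k X c(k) = (μ/2π) c(k)`, `X c(k) = Σ_{s∈{±e_j}} Û(s) × (i(k−s) × c(k−s) − c(k−s))`
  (`AbcLatticeEigenSynthesis.lerayCoeff_linSym_abcFlow`; `R = 1/(2πν)` in `AbcLatticeReality`'s letter).
* §3 **`exists_real_fourier_eigen_abc`** — REALITY: a rapidly decaying, transversal, mean-free,
  non-zero lattice solution with a REAL eigenvalue `μ` may be taken CONJUGATE-SYMMETRIC (the
  coefficient family of a real vector field): one of `c + Jc`, `i(c − Jc)` (`AbcLatticeReality.certifier_eigen_conj`,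
  `crossForm_add/_smul/_sub`, `add_conj_ne_zero_or`), with rapid decay / transversality / zero mode kept.
* §4 **`exists_eigenData_of_isLinNSEigenvalue_abc`** — THE DOOR BACKWARDS: if `μ ∈ ℝ` is an eigenvalue
  of the linearisation about `abcFlow A B C` with viscosity `ν` (`Torus.IsLinNSEigenvalue ν (abcFlow A B C) μ`),
  then there is `v ∈ E = ℓ²(ℤ³; ℂ³)` with `‖v‖ = 1`, `⇑v` rapidly decreasing, `P`-fixed
  (`lerayCLM k (v k) = v k`), REAL through `proj` (`(v(−k))_j = conj (v k)_j`), divergence-free through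
  `proj` (`Σ_j k_j (v k)_j = 0`) — the three linear constraints of `TransportGalerkin.box` —, an EXACT
  EIGENVECTOR `linOp ν (𝓕 abc) proj lerayCLM v = μ • v`, and satisfying the eigen-consistency hypothesis
  `hres` of `half_prediction_abc` with `λ = μ` (`TransportGalerkinEigen.tendsto_eigen_residual`); by
  `TransportGalerkinEigen.exists_smul_mem_box_of_rapidDecay` the seed hypothesis `ε • v ∈ W` is then
  satisfiable for radii with a polynomial floor (`exists_seed_mem_box_abc`).

So a certified X0 row feeds the KEEP theorem BY NAME: its `Torus.IsLinNSEigenvalue` conclusion is the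
only eigen input; what remains open are RESIDENCE (β3) and the Lyapunov certificates h₁/h₂/hL/htail.
Mathlib + the tree files cited; no new definitions.
-/

noncomputable section

namespace Summit.NavierStokesRegularity.FluidComputer.TransportGalerkinAbcEigen

open Set Filter Topology Finset MeasureTheory UnitAddTorus
open Literature.Analysis.FunctionSpaces Literature.Analysis.FunctionSpaces.Lattice
open Literature.Analysis.FunctionSpaces.Torus Literature.Analysis.FunctionSpaces.EuclideanSpace
open Literature.Analysis.ODE
open Literature.Analysis.FluidPDE Literature.Analysis.FluidPDE.ScalarFourier
open Literature.Analysis.FluidPDE.SteadyLattice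
open Summit.NavierStokesRegularity.FluidComputer.GalerkinLatticePhaseSpace
open Summit.NavierStokesRegularity.FluidComputer.TransportGalerkin
open Summit.NavierStokesRegularity.FluidComputer.TransportGalerkinRapid
open Summit.NavierStokesRegularity.FluidComputer.TransportGalerkinAbc
open Summit.NavierStokesRegularity.FluidComputer.TransportGalerkinLevelGenerators
open Summit.NavierStokesRegularity.FluidComputer.TransportGalerkinEigen
open Summit.NavierStokesRegularity.FluidComputer.TransportGalerkinEigenFourier
open Summit.NavierStokesRegularity.FluidComputer.AbcLatticeReality
open scoped ENNReal NNReal ComplexConjugate InnerProductSpace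

/-! ## §1 The conjugation `J` on lattice families -/

section Conj

/-- `J` preserves rapid decay: `m ↦ conj c(−m)` is rapidly decaying with `c`. -/
theorem rapidDecay_conj_neg {c : (Fin 3 → ℤ) → EuclideanSpace ℂ (Fin 3)} (hc : RapidDecay c) :
    RapidDecay (fun m => conjVec (c (-m))) := by
  intro n
  have h := (hc n).comp_injective neg_injective
  refine h.congr fun m => ?_
  simp only [Function.comp_apply, norm_conjVec, freqNormSq_neg]

/-- `J` preserves transversality. -/
theorem kdot_conj_neg {c : (Fin 3 → ℤ) → EuclideanSpace ℂ (Fin 3)}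
    (hct : ∀ k : Fin 3 → ℤ, ∑ j : Fin 3, ((k j : ℤ) : ℂ) * c k j = 0) (k : Fin 3 → ℤ) :
    ∑ j : Fin 3, ((k j : ℤ) : ℂ) * (conjVec (c (-k))) j = 0 := by
  have h : ∑ j : Fin 3, ((k j : ℤ) : ℂ) * (conjVec (c (-k))) j =
      -(starRingEnd ℂ (∑ j : Fin 3, (((-k) j : ℤ) : ℂ) * c (-k) j)) := by
    rw [map_sum, ← Finset.sum_neg_distrib]
    refine Finset.sum_congr rfl fun j _ => ?_
    rw [conjVec_apply, map_mul, map_intCast, Pi.neg_apply, Int.cast_neg]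
    ring
  rw [h, hct (-k), map_zero, neg_zero]

/-- Rapid decay, transversality and the zero mode for the two symmetrised families `c + Jc`,
`i(c − Jc)`. -/
theorem symmetrised_data {c : (Fin 3 → ℤ) → EuclideanSpace ℂ (Fin 3)} (hc : RapidDecay c)
    (hct : ∀ k : Fin 3 → ℤ, ∑ j : Fin 3, ((k j : ℤ) : ℂ) * c k j = 0) (hc0 : c 0 = 0) :
    (RapidDecay (fun m => c m + conjVec (c (-m))) ∧
      (∀ k : Fin 3 → ℤ, ∑ j : Fin 3, ((k j : ℤ) : ℂ) * (c k + conjVec (c (-k))) j = 0) ∧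
      c 0 + conjVec (c (-0)) = 0) ∧
    (RapidDecay (fun m => Complex.I • (c m - conjVec (c (-m)))) ∧
      (∀ k : Fin 3 → ℤ, ∑ j : Fin 3, ((k j : ℤ) : ℂ) * (Complex.I • (c k - conjVec (c (-k)))) j = 0) ∧
      Complex.I • (c 0 - conjVec (c (-0))) = 0) := by
  have hJ := rapidDecay_conj_neg hc
  refine ⟨⟨hc.add hJ, fun k => ?_, ?_⟩, ⟨(hc.sub' hJ).const_smul Complex.I, fun k => ?_, ?_⟩⟩
  · rw [kdot_add, hct k, kdot_conj_neg hct k, add_zero]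
  · rw [neg_zero, hc0, conjVec_zero, add_zero]
  · rw [kdot_smul, kdot_sub', hct k, kdot_conj_neg hct k, sub_zero, mul_zero]
  · rw [neg_zero, hc0, conjVec_zero, sub_zero, smul_zero]

end Conj

/-! ## §2 The lattice eigen-equation for the ABC host in the certifiers' form -/

section Certifier

/-- `⟨−k⟩ = ⟨k⟩`. -/
theorem sobolevWeight_neg_arg (s : ℝ) (k : Fin 3 → ℤ) : sobolevWeight s (-k) = sobolevWeight s k := by
  rw [sobolevWeight, sobolevWeight, freqNormSq_neg]

/-- **The tree's lattice eigen-equation about the ABC flow IS the certifiers' equation**, mode by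
mode: with `R = 1/(2πν)` and eigenvalue `μ = 2πλ`,
`ν·4π²|k|² c(k) + Π_k[N(Û,c) + N(c,Û)](k) + μ c(k) = 0 ↔ −(|k|²/R) c(k) + Π_k X c(k) = λ c(k)`
(`Π_k[N + N] = −2π Π_k X`, `AbcLatticeEigenSynthesis.lerayCoeff_linSym_abcFlow`; the right-hand side is
the letter of `AbcLatticeReality.certifier_eigen_conj` / `AbcLatticeEigenSynthesis.isLinNSEigenvalue_abcFlow_of_certifier_eigen`). -/
theorem abc_latticeEq_iff_certifierEq (A B C ν : ℝ) (lam : ℂ) (c : (Fin 3 → ℤ) → EuclideanSpace ℂ (Fin 3))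
    (k : Fin 3 → ℤ) :
    ((((ν * (4 * Real.pi ^ 2 * freqNormSq k)) : ℝ) : ℂ) • c k +
        Torus.lerayCoeff k ((WithLp.toLp 2 (fun p : Fin 3 => transportSym (fun j m =>
            (mFourierCoeff (complexify ∘ Torus.abcFlow A B C)) m j) (fun m => c m p) k) : EuclideanSpace ℂ (Fin 3)) +
          (WithLp.toLp 2 (fun p : Fin 3 => transportSym (fun j m => c m j) (fun m =>
            (mFourierCoeff (complexify ∘ Torus.abcFlow A B C)) m p) k) : EuclideanSpace ℂ (Fin 3))) +
        ((2 * Real.pi : ℂ) * lam) • c k = 0) ↔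
      (-(((freqNormSq k / (1 / (2 * Real.pi * ν)) : ℝ)) : ℂ) • c k +
        Torus.lerayCoeff k (∑ s ∈ Torus.abcFreq, (WithLp.toLp 2 (crossProduct
          (WithLp.ofLp (Torus.abcCoeff A B C s))
          (Complex.I • crossProduct (fun j => (((k - s) j : ℤ) : ℂ)) (WithLp.ofLp (c (k - s))) -
            WithLp.ofLp (c (k - s)))) : EuclideanSpace ℂ (Fin 3))) = lam • c k) := by
  rw [AbcLatticeEigenSynthesis.lerayCoeff_linSym_abcFlow A B C c k]
  have hπ : (Real.pi : ℂ) ≠ 0 := by exact_mod_cast Real.pi_ne_zero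
  have h2π : (2 * Real.pi : ℂ) ≠ 0 := mul_ne_zero two_ne_zero hπ
  have hR : ((freqNormSq k / (1 / (2 * Real.pi * ν)) : ℝ) : ℂ) = 2 * Real.pi * (ν * freqNormSq k) := by
    rw [div_div_eq_mul_div, div_one]; push_cast; ring
  have hs : (((ν * (4 * Real.pi ^ 2 * freqNormSq k)) : ℝ) : ℂ) = (2 * Real.pi : ℂ) * (2 * Real.pi * (ν * freqNormSq k)) := by
    push_cast; ring
  rw [hR, hs]
  constructor
  · intro h
    have key : (2 * Real.pi : ℂ) • ((2 * Real.pi * (ν * freqNormSq k) : ℂ) • c k -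
        Torus.lerayCoeff k (∑ s ∈ Torus.abcFreq, (WithLp.toLp 2 (crossProduct
          (WithLp.ofLp (Torus.abcCoeff A B C s))
          (Complex.I • crossProduct (fun j => (((k - s) j : ℤ) : ℂ)) (WithLp.ofLp (c (k - s))) -
            WithLp.ofLp (c (k - s)))) : EuclideanSpace ℂ (Fin 3))) + lam • c k) = 0 := by
      rw [← h]; module
    rw [smul_eq_zero, or_iff_right h2π] at key
    linear_combination (norm := module) (-1 : ℂ) • key
  · intro h
    linear_combination (norm := module) (-(2 * Real.pi : ℂ)) • h

end Certifier

/-! ## §3 Reality: a real eigenvalue has a conjugate-symmetric lattice eigenfamily -/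

section Reality

/-- **A real eigenvalue of the ABC lattice operator has a conjugate-symmetric (real-field) rapidly
decaying eigenfamily.** If a rapidly decaying, transversal, mean-free, non-zero `c` solves the tree's
lattice eigen-equation about `abcFlow A B C` with a REAL eigenvalue `2πλ`, then so does a
CONJUGATE-SYMMETRIC `d` with the same properties (`d = c + Jc` or `i(c − Jc)`, via
`AbcLatticeReality.certifier_eigen_conj` and the linearity of the cross form). -/
theorem exists_real_fourier_eigen_abc (A B C ν lam : ℝ) {c : (Fin 3 → ℤ) → EuclideanSpace ℂ (Fin 3)}
    (hc : RapidDecay c) (hct : ∀ k : Fin 3 → ℤ, ∑ j : Fin 3, ((k j : ℤ) : ℂ) * c k j = 0) (hc0 : c 0 = 0)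
    (hcne : c ≠ 0)
    (heq : ∀ k : Fin 3 → ℤ, (((ν * (4 * Real.pi ^ 2 * freqNormSq k)) : ℝ) : ℂ) • c k +
        Torus.lerayCoeff k ((WithLp.toLp 2 (fun p : Fin 3 => transportSym (fun j m =>
            (mFourierCoeff (complexify ∘ Torus.abcFlow A B C)) m j) (fun m => c m p) k) : EuclideanSpace ℂ (Fin 3)) +
          (WithLp.toLp 2 (fun p : Fin 3 => transportSym (fun j m => c m j) (fun m =>
            (mFourierCoeff (complexify ∘ Torus.abcFlow A B C)) m p) k) : EuclideanSpace ℂ (Fin 3))) +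
        ((2 * Real.pi : ℂ) * (lam : ℂ)) • c k = 0) :
    ∃ d : (Fin 3 → ℤ) → EuclideanSpace ℂ (Fin 3), RapidDecay d ∧
      (∀ k : Fin 3 → ℤ, ∑ j : Fin 3, ((k j : ℤ) : ℂ) * d k j = 0) ∧ d 0 = 0 ∧ d ≠ 0 ∧ IsConjSymm d ∧
      ∀ k : Fin 3 → ℤ, (((ν * (4 * Real.pi ^ 2 * freqNormSq k)) : ℝ) : ℂ) • d k +
        Torus.lerayCoeff k ((WithLp.toLp 2 (fun p : Fin 3 => transportSym (fun j m =>
            (mFourierCoeff (complexify ∘ Torus.abcFlow A B C)) m j) (fun m => d m p) k) : EuclideanSpace ℂ (Fin 3)) +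
          (WithLp.toLp 2 (fun p : Fin 3 => transportSym (fun j m => d m j) (fun m =>
            (mFourierCoeff (complexify ∘ Torus.abcFlow A B C)) m p) k) : EuclideanSpace ℂ (Fin 3))) +
        ((2 * Real.pi : ℂ) * (lam : ℂ)) • d k = 0 := by
  -- the certifiers' form (`R = 1/(2πν)`) for `c` and for `Jc`
  have hcert : ∀ k : Fin 3 → ℤ,
      -(((freqNormSq k / (1 / (2 * Real.pi * ν)) : ℝ)) : ℂ) • c k +
        Torus.lerayCoeff k (∑ s ∈ Torus.abcFreq, (WithLp.toLp 2 (crossProduct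
          (WithLp.ofLp (Torus.abcCoeff A B C s))
          (Complex.I • crossProduct (fun j => (((k - s) j : ℤ) : ℂ)) (WithLp.ofLp (c (k - s))) -
            WithLp.ofLp (c (k - s)))) : EuclideanSpace ℂ (Fin 3))) = (lam : ℂ) • c k := fun k =>
    (abc_latticeEq_iff_certifierEq A B C ν (lam : ℂ) c k).1 (heq k)
  have hJ : ∀ k : Fin 3 → ℤ,
      -(((freqNormSq k / (1 / (2 * Real.pi * ν)) : ℝ)) : ℂ) • conjVec (c (-k)) +
        Torus.lerayCoeff k (∑ s ∈ Torus.abcFreq, (WithLp.toLp 2 (crossProduct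
          (WithLp.ofLp (Torus.abcCoeff A B C s))
          (Complex.I • crossProduct (fun j => (((k - s) j : ℤ) : ℂ)) (WithLp.ofLp (conjVec (c (-(k - s))))) -
            WithLp.ofLp (conjVec (c (-(k - s)))))) : EuclideanSpace ℂ (Fin 3))) =
        (lam : ℂ) • conjVec (c (-k)) := fun k => by
    have h := certifier_eigen_conj A B C (1 / (2 * Real.pi * ν)) (lam : ℂ) c hcert k
    rwa [Complex.conj_ofReal] at h
  -- the two symmetrised candidates solve the certifiers' equation
  have hd1 : ∀ k : Fin 3 → ℤ,
      -(((freqNormSq k / (1 / (2 * Real.pi * ν)) : ℝ)) : ℂ) • (c k + conjVec (c (-k))) +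
        Torus.lerayCoeff k (∑ s ∈ Torus.abcFreq, (WithLp.toLp 2 (crossProduct
          (WithLp.ofLp (Torus.abcCoeff A B C s))
          (Complex.I • crossProduct (fun j => (((k - s) j : ℤ) : ℂ))
            (WithLp.ofLp (c (k - s) + conjVec (c (-(k - s))))) -
            WithLp.ofLp (c (k - s) + conjVec (c (-(k - s)))))) : EuclideanSpace ℂ (Fin 3))) =
        (lam : ℂ) • (c k + conjVec (c (-k))) := fun k => by
    rw [crossForm_add A B C c (fun m => conjVec (c (-m))) k, lerayCoeff_add', smul_add, smul_add,
      ← hcert k, ← hJ k]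
    abel
  have hd2 : ∀ k : Fin 3 → ℤ,
      -(((freqNormSq k / (1 / (2 * Real.pi * ν)) : ℝ)) : ℂ) • (Complex.I • (c k - conjVec (c (-k)))) +
        Torus.lerayCoeff k (∑ s ∈ Torus.abcFreq, (WithLp.toLp 2 (crossProduct
          (WithLp.ofLp (Torus.abcCoeff A B C s))
          (Complex.I • crossProduct (fun j => (((k - s) j : ℤ) : ℂ))
            (WithLp.ofLp (Complex.I • (c (k - s) - conjVec (c (-(k - s)))))) -
            WithLp.ofLp (Complex.I • (c (k - s) - conjVec (c (-(k - s))))))) : EuclideanSpace ℂ (Fin 3))) =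
        (lam : ℂ) • (Complex.I • (c k - conjVec (c (-k)))) := fun k => by
    rw [crossForm_smul A B C Complex.I (fun m => c m - conjVec (c (-m))) k,
      crossForm_sub A B C c (fun m => conjVec (c (-m))) k, lerayCoeff_smul', lerayCoeff_sub',
      smul_comm (-(((freqNormSq k / (1 / (2 * Real.pi * ν)) : ℝ)) : ℂ)) Complex.I, ← smul_add, smul_sub, sub_add_sub_comm,
      hcert k, hJ k, ← smul_sub, smul_comm]
  -- the bookkeeping of §1 and the choice of a non-zero candidate
  obtain ⟨⟨hr1, ht1, hz1⟩, ⟨hr2, ht2, hz2⟩⟩ := symmetrised_data hc hct hc0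
  obtain ⟨k₀, hk₀⟩ : ∃ k, c k ≠ 0 := by
    by_contra h
    push Not at h
    exact hcne (funext h)
  rcases add_conj_ne_zero_or c hk₀ with h1 | h2
  · have hE : ∀ k, _ := fun k =>
      (abc_latticeEq_iff_certifierEq A B C ν (lam : ℂ) (fun m => c m + conjVec (c (-m))) k).2 (hd1 k)
    exact ⟨fun m => c m + conjVec (c (-m)), hr1, ht1, hz1, fun h0 => h1 (congrFun h0 k₀),
      isConjSymm_add_conj c, hE⟩
  · have hE : ∀ k, _ := fun k =>
      (abc_latticeEq_iff_certifierEq A B C ν (lam : ℂ) (fun m => Complex.I • (c m - conjVec (c (-m)))) k).2 (hd2 k)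
    exact ⟨fun m => Complex.I • (c m - conjVec (c (-m))), hr2, ht2, hz2, fun h0 => h2 (congrFun h0 k₀),
      isConjSymm_I_smul_sub_conj c, hE⟩

end Reality

/-! ## §4 The X0 door read backwards: the eigen data of `half_prediction_abc` from a certified real eigenvalue -/

section Door

/-- **THE DOOR BACKWARDS.** If `μ ∈ ℝ` is an eigenvalue of the linearised Navier–Stokes operator about
the ABC flow with viscosity `ν` (`Torus.IsLinNSEigenvalue ν (abcFlow A B C) μ` — the conclusion of the
cell's X0 chains), then the (β2) chain's operator `linOp ν (𝓕 abc) proj lerayCLM` has a UNIT, rapidly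
decreasing, REAL (conjugate-symmetric through `proj`), divergence-free, `P`-fixed EXACT EIGENVECTOR
`v ∈ E` with eigenvalue `μ`, and `v` satisfies the eigen-consistency hypothesis `hres` of
`TransportGalerkinAbc.half_prediction_abc` with `λ = μ`. -/
theorem exists_eigenData_of_isLinNSEigenvalue_abc (A B C : ℝ) {ν μ : ℝ}
    (h : Torus.IsLinNSEigenvalue ν (Torus.abcFlow A B C) (μ : ℂ)) :
    ∃ v : lp (fun _ : (Fin 3 → ℤ) => EuclideanSpace ℂ (Fin 3)) 2,
      ‖v‖ = 1 ∧ RapidDecay (⇑v) ∧ (∀ k, lerayCLM k (v k) = v k) ∧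
      (∀ (j : Fin 3) (k : Fin 3 → ℤ), (EuclideanSpace.proj j : EuclideanSpace ℂ (Fin 3) →L[ℂ] ℂ) (v (-k)) =
        conj ((EuclideanSpace.proj j : EuclideanSpace ℂ (Fin 3) →L[ℂ] ℂ) (v k))) ∧
      (∀ k : Fin 3 → ℤ, ∑ j, ((k j : ℤ) : ℂ) * (EuclideanSpace.proj j : EuclideanSpace ℂ (Fin 3) →L[ℂ] ℂ) (v k) = 0) ∧
      linOp ν (mFourierCoeff (complexify ∘ Torus.abcFlow A B C))
          (fun j => (EuclideanSpace.proj j : EuclideanSpace ℂ (Fin 3) →L[ℂ] ℂ)) lerayCLM v = μ • v ∧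
      Tendsto (fun n => ‖cubeProj n (linOp ν (mFourierCoeff (complexify ∘ Torus.abcFlow A B C))
          (fun j => (EuclideanSpace.proj j : EuclideanSpace ℂ (Fin 3) →L[ℂ] ℂ)) lerayCLM (cubeProj n v)) -
        μ • cubeProj n v‖) atTop (𝓝 0) := by
  obtain ⟨w, hwne, hrel⟩ := h
  obtain ⟨hc, hct, hc0, heq⟩ := fourier_eigen_of_linNSResolventRel (Torus.isSmooth_abcFlow A B C) hrel
  have hcne : mFourierCoeff w ≠ 0 := mFourierCoeff_ne_zero hrel.1.continuous hwne
  -- a real lattice eigenfamily (`μ = 2π·(μ/2π)`)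
  have hμ : (μ : ℂ) = (2 * Real.pi : ℂ) * ((μ / (2 * Real.pi) : ℝ) : ℂ) := by
    push_cast; field_simp
  rw [hμ] at heq
  obtain ⟨d, hd, hdt, hd0, hdne, hdsym, hdeq⟩ :=
    exists_real_fourier_eigen_abc A B C ν (μ / (2 * Real.pi)) hc hct hc0 hcne heq
  rw [← hμ] at hdeq
  -- the scaled element `x = Λ² d ∈ E` is an exact eigenvector
  set x : lp (fun _ : (Fin 3 → ℤ) => EuclideanSpace ℂ (Fin 3)) 2 := ofCoeff (wmul 2 d) with hxdef
  have hx : (x : (Fin 3 → ℤ) → EuclideanSpace ℂ (Fin 3)) = wmul 2 d := coe_ofCoeff_wmul hd 2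
  have hxr : RapidDecay (⇑x) := by rw [hx]; exact rapidDecay_wmul hd 2
  have hAx : linOp ν (mFourierCoeff (complexify ∘ Torus.abcFlow A B C))
      (fun j => (EuclideanSpace.proj j : EuclideanSpace ℂ (Fin 3) →L[ℂ] ℂ)) lerayCLM x = (μ : ℂ) • x :=
    linOp_eq_smul_of_fourier_eigen (rapidDecay_abcHost A B C) hd hdt hd0
      (fun k => by rw [lerayCLM_apply]; exact hdeq k) hx
  -- `x ≠ 0`
  obtain ⟨k₀, hk₀⟩ : ∃ k, d k ≠ 0 := by
    by_contra h0
    push Not at h0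
    exact hdne (funext h0)
  have hxne : x ≠ 0 := by
    intro h0
    apply hk₀
    have h1 : (x : (Fin 3 → ℤ) → EuclideanSpace ℂ (Fin 3)) k₀ = 0 := by rw [h0]; rfl
    rw [hx, wmul_apply, smul_eq_zero] at h1
    exact h1.resolve_left (by exact_mod_cast (sobolevWeight_pos 2 k₀).ne')
  have hxn : 0 < ‖x‖ := norm_pos_iff.2 hxne
  -- the unit vector `v = ‖x‖⁻¹ • x`
  set r : ℝ := ‖x‖⁻¹ with hr
  have hr0 : 0 < r := inv_pos.2 hxn
  refine ⟨r • x, ?_, ?_, fun k => ?_, fun j k => ?_, fun k => ?_, ?_, ?_⟩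
  · rw [norm_smul, Real.norm_of_nonneg hr0.le, hr, inv_mul_cancel₀ hxn.ne']
  · rw [lp.coeFn_smul]; exact hxr.const_smul (r : ℂ)
  · rw [coe_real_smul_apply, map_smul, hx, wmul_apply, map_smul, lerayCLM_apply_of_transversal hdt hd0 k]
  · have e1 : (r • x) (-k) = ((r : ℂ) * (sobolevWeight 2 k : ℂ)) • conjVec (d k) := by
      rw [coe_real_smul_apply, hx, wmul_apply, sobolevWeight_neg_arg, hdsym k, smul_smul]
    have e2 : (r • x) k = ((r : ℂ) * (sobolevWeight 2 k : ℂ)) • d k := by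
      rw [coe_real_smul_apply, hx, wmul_apply, smul_smul]
    rw [e1, e2, map_smul, map_smul, smul_eq_mul, smul_eq_mul,
      show (EuclideanSpace.proj j : EuclideanSpace ℂ (Fin 3) →L[ℂ] ℂ) (conjVec (d k)) = conj (d k j) from rfl,
      show (EuclideanSpace.proj j : EuclideanSpace ℂ (Fin 3) →L[ℂ] ℂ) (d k) = d k j from rfl,
      map_mul, map_mul, Complex.conj_ofReal, Complex.conj_ofReal]
  · calc ∑ j, ((k j : ℤ) : ℂ) * (EuclideanSpace.proj j : EuclideanSpace ℂ (Fin 3) →L[ℂ] ℂ) ((r • x) k)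
        = ((r : ℂ) * (sobolevWeight 2 k : ℂ)) * ∑ j, ((k j : ℤ) : ℂ) * d k j := by
          rw [Finset.mul_sum]
          refine Finset.sum_congr rfl fun j _ => ?_
          rw [coe_real_smul_apply, hx, wmul_apply, map_smul, map_smul,
            show (EuclideanSpace.proj j : EuclideanSpace ℂ (Fin 3) →L[ℂ] ℂ) (d k) = d k j from rfl, smul_eq_mul,
            smul_eq_mul]
          ring
      _ = 0 := by rw [hdt k, mul_zero]
  · rw [linOp_smul_of_rapidDecay (rapidDecay_abcHost A B C) norm_lerayCLM_le r hxr, hAx]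
    apply lp.ext
    rw [lp.coeFn_smul, lp.coeFn_smul, lp.coeFn_smul, lp.coeFn_smul]
    funext k
    simp only [Pi.smul_apply, ← Complex.coe_smul, smul_smul, mul_comm]
  · have hv : RapidDecay (⇑(r • x)) := by rw [lp.coeFn_smul]; exact hxr.const_smul (r : ℂ)
    have hAv : linOp ν (mFourierCoeff (complexify ∘ Torus.abcFlow A B C))
        (fun j => (EuclideanSpace.proj j : EuclideanSpace ℂ (Fin 3) →L[ℂ] ℂ)) lerayCLM (r • x) = μ • (r • x) := by
      rw [linOp_smul_of_rapidDecay (rapidDecay_abcHost A B C) norm_lerayCLM_le r hxr, hAx]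
      apply lp.ext
      rw [lp.coeFn_smul, lp.coeFn_smul, lp.coeFn_smul, lp.coeFn_smul]
      funext k
      simp only [Pi.smul_apply, ← Complex.coe_smul, smul_smul, mul_comm]
    exact tendsto_eigen_residual (rapidDecay_abcHost A B C) norm_proj_le norm_lerayCLM_le hv hAv

/-- **The seed hypothesis is then satisfiable**: for radii with a polynomial floor `C⟨k⟩^{−s} ≤ ρ k`
(`C > 0`), all small real multiples `ε • v` of the eigenvector of
`exists_eigenData_of_isLinNSEigenvalue_abc` lie in the box `W = box ρ proj lerayCLM` of
`half_prediction_abc` (`TransportGalerkinEigen.exists_smul_mem_box_of_rapidDecay`). -/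
theorem exists_seed_mem_box_abc {ρ : (Fin 3 → ℤ) → ℝ} {C s : ℝ} (hC : 0 < C)
    (hρ : ∀ k, C * sobolevWeight (-s) k ≤ ρ k)
    {v : lp (fun _ : (Fin 3 → ℤ) => EuclideanSpace ℂ (Fin 3)) 2} (hvr : RapidDecay (⇑v))
    (hP : ∀ k, lerayCLM k (v k) = v k)
    (hreal : ∀ (j : Fin 3) (k : Fin 3 → ℤ), (EuclideanSpace.proj j : EuclideanSpace ℂ (Fin 3) →L[ℂ] ℂ) (v (-k)) =
        conj ((EuclideanSpace.proj j : EuclideanSpace ℂ (Fin 3) →L[ℂ] ℂ) (v k)))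
    (hdiv : ∀ k : Fin 3 → ℤ, ∑ j, ((k j : ℤ) : ℂ) * (EuclideanSpace.proj j : EuclideanSpace ℂ (Fin 3) →L[ℂ] ℂ) (v k) = 0) :
    ∃ ε₀ : ℝ, 0 < ε₀ ∧ ∀ ε : ℝ, |ε| ≤ ε₀ →
      ε • v ∈ box ρ (fun j => (EuclideanSpace.proj j : EuclideanSpace ℂ (Fin 3) →L[ℂ] ℂ)) lerayCLM :=
  exists_smul_mem_box_of_rapidDecay hvr hP hreal hdiv hC hρ

end Door

end Summit.NavierStokesRegularity.FluidComputer.TransportGalerkinAbcEigen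

end
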